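import Summits.QuantumFields.YangMills.Theorems.BalabanUVNodesN07SectBFlatHessian
import Literature.MathematicalPhysics.QuantumFieldTheory.Balaban1983to89.Node00.WilsonActionFirstVariationCoDiv
import Summits.QuantumFields.YangMills.Theorems.BalabanUVNodesK0Stub1FlatCoercivityAtRecord
import Summits.QuantumFields.YangMills.Theorems.BalabanUVNodesK0Stub1CriticalEquation143CoordFree
import Summits.QuantumFields.YangMills.Theorems.UnitScaleTiltProp8ChartHInvComb
import HarnessLib

/-!
# K0⁷ STUB 1 (`stub_prop8StepCoP13`), sub-target S4a, THE FLAT JUNCTION WITH S1: **THE HESSIAN OPERATOR OF RECORD AT THE TRIVIAL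
# BACKGROUND, `Δ_1 = Node00.hessOpAt η 1` (dag-n07-w1, S1), IS COERCIVE ON THE LANDAU ∩ `ker Q_k` TANGENT SPACE OF 𝔰𝔲(N)-VALUED BOND FIELDS
# OF THE RECORD'S FINE TORUS, UNIFORMLY IN `k` AND IN THE VOLUME** — [Balaban1984PropagatorsI] Prop. 1.1 (1.90) («`Δ_a = G⁻¹ ≥ γ₀(Δ + I)`,
# `γ₀` independent of `k`, `T_η`») read ENTRYWISE on S1's carrier `TangentBondSU (F.P K) 0 N`; hence this seat's file 2 (`…CriticalEquation143CoordFree`)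
# has its ONE hypothesis `hpos` DISCHARGED on S1's carrier at the flat background, and print's `G̃` of (143)∕(158) EXISTS there with a `k`-uniform `L²` letter

Cell `pub-ymgap`, width seat `pub-ymgap-k0-s1-w1` g2 (trigger (t1) of g0's HANDOFF: S1 = `Node00/HessianOperatorAtBackground` p587895 + `…N07SectBExpansionAtObjects`
v1.2 p589486 LANDED; dag-n07-w1 l.25850: «the flat junction k0-s1-w1∕w2 write the [B5]–[B6]∕UST operator theorems against»).  `--kind proof --supports
stmt-QuantumFields-20541 --as helper`; count-neutral.  [15] = [Balaban1985Variational] (CMP **102** (1985) 277–309); [B5] = [Balaban1984PropagatorsI] (CMP **95**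
(1984) 17–40); [5] = [Balaban1985BackgroundPropagators] (CMP **99** (1985) 389–434).

WHY.  File 2 of this seat derives [15] (127) ⟹ (143) ⟹ (158) over an ARBITRARY finite-dimensional real inner-product space from ONE hypothesis `hpos`
(`Δ` positive on the tangent space); file 3 reads [B5] (1.90) at the record on REAL SCALAR bond fields (UST `Prop7FlatCoercivity`, `L²`, Hodge form, full Landau
divergence).  S1 has now typed THE carrier and THE operator of the record: `E = TangentBondSU P j N` (𝔰𝔲(N)-valued bond fields, `⟪X, Y⟫ = Σ_b Re tr(X_b* Y_b)`) and
`Δ_{U₀} = hessOpAt η U₀` (`⟪X, Δ_{U₀}X⟫ = Re⟨A_X, Δ^η(U₀)A_X⟩`, [5] (3.10) ∕ [15] (26)), whose form at `U₀ = 1` is `N⁻¹·Σ_p Re tr((dX)(p)*(dX)(p))`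
(`Node00.hessFormAt_one_self`).  Print (p. 288, p. 302): the operators of Sect. F act on Lie-algebra-valued fields with «suppressed matrix indices» — ENTRYWISE.
THIS FILE does the entrywise reading once: each entry's real and imaginary part is a real scalar bond field to which file 3's (1.90) applies; summing over the
`2N²` components gives (1.90) for `Δ_1` on S1's carrier, hence `hpos` there.

WHAT IS PROVED (sorry-free; no definition; axioms standard).
* §0 `normSq_tangentBondSU_eq_sum_entries` (`‖X‖² = Σ_b Σ_{ii′} |X_b,ii′|²`); `map_curl` ∕ `map_diverg` and the entrywise `re`∕`im` of `curl 1`, `diverg 1`, `Q_k = bondAvgIter k`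
  (naturality; for `Q_k` = UST `ChartHInv.bondAvgIter_comp_apply`, cited).
* §1 `curl_torusT_one_eq_curl_one` (pv27's curl (3.4) at `U ≡ 1` IS `LatticeFieldCalculus.curl 1` on `Plaq`), ★ `inner_hessOpAt_one_self_eq_sum_curl_normSq`
  (`⟪X, Δ_1X⟫ = N⁻¹·Σ_{p : Plaq} Σ_{ii′} |(curl 1 X)(p)_{ii′}|²`), `inner_hessOpAt_one_self_eq_sum_curl_re_im` (split into the `2N²` real components).
* §2 ★★ `normSq_le_bondAvgIter_add_hessOpAt_add_diverg_T4` — (1.90), Hodge form, for 𝔰𝔲(N)-valued `X` on `Site (F.P K) 0`, `k ≤ m + K`: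
  `‖X‖² ≤ 2L^{4k}·Σ_c Σ_{ii′}|(Q_kX)(c)_{ii′}|² + (17∕8)L^{2k}·(N·⟪X, Δ_1X⟫ + Σ_x Σ_{ii′}|(∂*X)(x)_{ii′}|²)`; ★★ `hessOpAt_one_coercive_of_landau_of_bondAvgIter_eq_zero_T4`
  — `∂*X = 0`, `Q_kX = 0` ⇒ `(8∕17)·L^{−2k}·‖X‖² ≤ N·⟪X, Δ_1X⟫`.
* §3 ★ `re_bondPair_le_re_hessPair_of_landau_T4` — the same in PRINT's pairing (3.11) at `η = η_k = L^{−k}`: `(8∕17)·Re⟨A_X, A_X⟩ ≤ Re⟨A_X, Δ^{η_k}(1)A_X⟩`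
  («`Δ(1) ≥ γ₀` on the Landau tangent space», `γ₀ = 8∕17`, `k`- and volume-uniform; S1's `re_bondPair_hermLetter`, `inner_hessOpAt_self`).
* §4 ★ `hessOpAt_one_pos_of_le_landau_ker_T4` (file 2's `hpos` for `Δ := Δ_1` on every submodule `T ⊆` Landau ∩ `ker Q_k`), `norm_restricted_solution_hessOpAt_le_T4`,
  ★ `exists_flatGt_hessOpAt_T4` (print's `G̃` = the restricted solution operator of `Δ_1` on `T`: exists, linear, values in `T`, unique, `‖G̃w‖ ≤ (17∕8)·N·L^{2k}·‖w‖`),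
  ★ `exists_Gt_eq158_hessOpAt_T4` ((127) ⟹ (158) ON S1's CARRIER, flat, for every constraint map `Qc` with `ker Qc ⊆` Landau ∩ `ker Q_k` and every right inverse `H`
  with `Δ_1`-orthogonal range — file 2's `exists_Gt_eq158_of_critical128`, `hpos` DISCHARGED).
HONEST SCOPE.  (i) ONE averaging level in the straight-line letters `Q_k = LatticeFieldCalculus.bondAvgIter k` (its identification with the linearisation of the
record's (0.4) descent is UST `Prop7IterLinearisationFlat`, not read here), whole torus, FLAT background, FULL Landau condition `∂*X = 0` (print's Sect. F tangent space
carries `R∂*` with the residual projection `R` — UST `Prop7FlatCoercivityR` is that variant on scalar fields; its 𝔰𝔲(N) twin is the same entrywise sum once S1 types `R`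
on 𝔰𝔲(N)-valued fields); the multi-level `genSet` tangent space and the cube (144) boundary conditions are NOT treated.  (ii) The small-field operator `Δ_{U₀}`, `U₀ ≠ 1`
([5] Thm 3.11 proper) is NOT here (file 3 §2 has the covariant `L²` core).  (iii) Nothing of Bałaban's analysis asserted beyond the tree theorems cited; `stub_prop8StepCoP13` ∕
K0⁷ NOT closed; N07 NOT discharged; counts unmoved (28∕28 · 5∕27); one finite 𝕋⁴ programme at fixed ε — R4 closes the conditional finite-𝕋⁴ rung `BalabanLadder.UV` only,
never the summit; the YM mass gap (Clay) is NOT proved by any of this; nothing continuum ∕ ℝ⁴ ∕ OS.  No `sorry`, no `def`, no `instance`, no `notation`.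

References: [B5] Prop. 1.1 (1.89)–(1.90) p.33, (1.2), (1.18), (1.21); [5] (3.4), (3.10)–(3.11) pp.391–392, Thm 3.11 p.416; [15] (26), p.288, (127)–(133), (143), (158).
-/

set_option autoImplicit false
noncomputable section
open scoped BigOperators InnerProductSpace RealInnerProductSpace

namespace Summit.QuantumFields.YangMills.Theorems.K0Stub1FlatHessianLandauCoercivity

open Literature.MathematicalPhysics.QuantumFieldTheory.Balaban1983to89
open Literature.MathematicalPhysics.QuantumFieldTheory.Balaban1983to89.Node00
open Literature.MathematicalPhysics.QuantumFieldTheory.Balaban1983to89.T4Continuum (T4Family)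
open T4AdjointCovarianceUnitary (lieSU)
open B9TorusCalculus (torusT)
open LatticeFieldCalculus (curl diverg bondAvgIter)
open Summit.QuantumFields.YangMills.Theorems.K0Stub1FlatCoercivityAtRecord (curl_sq_ge_of_landau_of_bondAvgIter_eq_zero_T4
  sum_sq_le_bondAvgIter_add_curl_add_diverg_T4)
open Summit.QuantumFields.YangMills.Theorems.K0Stub1CriticalEquation143CoordFree (exists_restrictedSolutionOp exists_Gt_eq158_of_critical128)
open Summit.QuantumFields.YangMills.Theorems.ChartHInv (bondAvgIter_comp_apply)
open Summit.QuantumFields.YangMills.BalabanUVNodes.N07SectBFlatHessian (curl_torusT_one_eq_pdiff)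

variable {N : ℕ} {P : Params} {j : ℕ}

/-! ## §0  Dictionary: the carrier's norm entrywise; linear maps of the coefficients commute with the lattice calculus -/

/-- **THE CARRIER's NORM ENTRYWISE**: `‖X‖² = Σ_b Σ_{i,i′} |(X_b)_{ii′}|²` (`⟪X, X⟫ = Σ_b Re tr(X_b* X_b)`, S1 `inner_tangentBondSU`, and `Re tr(M*M) = Σ|M_{ii′}|²`).
[cite: Balaban1985Averaging, (17) p.21; Balaban1985BackgroundPropagators, p.391] -/
theorem normSq_tangentBondSU_eq_sum_entries (X : TangentBondSU P j N) :
    ‖X‖ ^ 2 = ∑ b : PBond P j, ∑ i, ∑ i', ‖((X b : lieSU (Fin N)) : Matrix (Fin N) (Fin N) ℂ) i i'‖ ^ 2 := by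
  rw [← real_inner_self_eq_norm_sq, inner_tangentBondSU]
  refine Finset.sum_congr rfl fun b _ => ?_
  rw [MatrixNorms.sum_norm_sq_eq_re_trace]

/-- An `ℝ`-linear map of the coefficients commutes with the plaquette curl of `LatticeFieldCalculus` ([B5] (1.2)). [folklore] -/
theorem map_curl {V W : Type*} [AddCommGroup V] [Module ℝ V] [AddCommGroup W] [Module ℝ W] (φ : V →ₗ[ℝ] W) (c : ℝ)
    (A : VecField P j V) (p : Plaq P j) : φ (curl c A p) = curl c (fun b => φ (A b)) p := by
  simp only [LatticeFieldCalculus.curl, map_smul, map_add, map_sub]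

/-- An `ℝ`-linear map of the coefficients commutes with the divergence of `LatticeFieldCalculus` ([B5] (1.21)). [folklore] -/
theorem map_diverg {V W : Type*} [AddCommGroup V] [Module ℝ V] [AddCommGroup W] [Module ℝ W] (φ : V →ₗ[ℝ] W) (c : ℝ)
    (A : VecField P j V) (x : Site P j) : φ (diverg c A x) = diverg c (fun b => φ (A b)) x := by
  simp only [LatticeFieldCalculus.diverg, map_sum, map_smul, map_sub]

/-- Entrywise real part of the curl (`map_curl` at the functional `re ∘ (·)_{ii′}`). [cite: Balaban1984PropagatorsI, (1.2) p.18] -/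
theorem curl_entry_re {c : ℝ} (A : VecField P j (Matrix (Fin N) (Fin N) ℂ)) (p : Plaq P j) (i i' : Fin N) :
    (curl c A p i i').re = curl c (fun b => (A b i i').re) p := map_curl (Complex.reLm ∘ₗ Matrix.entryLinearMap ℝ ℂ i i') c A p

/-- Entrywise imaginary part of the curl. [cite: Balaban1984PropagatorsI, (1.2) p.18] -/
theorem curl_entry_im {c : ℝ} (A : VecField P j (Matrix (Fin N) (Fin N) ℂ)) (p : Plaq P j) (i i' : Fin N) :
    (curl c A p i i').im = curl c (fun b => (A b i i').im) p := map_curl (Complex.imLm ∘ₗ Matrix.entryLinearMap ℝ ℂ i i') c A p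

/-- Entrywise real part of the divergence. [cite: Balaban1984PropagatorsI, (1.21) p.21] -/
theorem diverg_entry_re {c : ℝ} (A : VecField P j (Matrix (Fin N) (Fin N) ℂ)) (x : Site P j) (i i' : Fin N) :
    (diverg c A x i i').re = diverg c (fun b => (A b i i').re) x := map_diverg (Complex.reLm ∘ₗ Matrix.entryLinearMap ℝ ℂ i i') c A x

/-- Entrywise imaginary part of the divergence. [cite: Balaban1984PropagatorsI, (1.21) p.21] -/
theorem diverg_entry_im {c : ℝ} (A : VecField P j (Matrix (Fin N) (Fin N) ℂ)) (x : Site P j) (i i' : Fin N) :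
    (diverg c A x i i').im = diverg c (fun b => (A b i i').im) x := map_diverg (Complex.imLm ∘ₗ Matrix.entryLinearMap ℝ ℂ i i') c A x

/-- Entrywise real part of `Q_k` (UST `ChartHInv.bondAvgIter_comp_apply` at `re ∘ (·)_{ii′}`). [cite: Balaban1984PropagatorsI, (1.18) p.20] -/
theorem bondAvgIter_entry_re (k : ℕ) (A : VecField P 0 (Matrix (Fin N) (Fin N) ℂ)) (c : PBond P k) (i i' : Fin N) :
    (bondAvgIter k A c i i').re = bondAvgIter k (fun b => (A b i i').re) c :=
  (bondAvgIter_comp_apply (Complex.reLm ∘ₗ Matrix.entryLinearMap ℝ ℂ i i') k A c).symm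

/-- Entrywise imaginary part of `Q_k`. [cite: Balaban1984PropagatorsI, (1.18) p.20] -/
theorem bondAvgIter_entry_im (k : ℕ) (A : VecField P 0 (Matrix (Fin N) (Fin N) ℂ)) (c : PBond P k) (i i' : Fin N) :
    (bondAvgIter k A c i i').im = bondAvgIter k (fun b => (A b i i').im) c :=
  (bondAvgIter_comp_apply (Complex.imLm ∘ₗ Matrix.entryLinearMap ℝ ℂ i i') k A c).symm

/-! ## §1  The flat Hessian form of record in the letters of `LatticeFieldCalculus` -/

/-- Corollary of dag-n07-w1's `N07SectBFlatHessian.curl_torusT_one_eq_pdiff` (pv27's curl (3.4) at `U ≡ 1` = `δ_μX_ν − δ_νX_μ`) in the currency used below: on a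
positively oriented plaquette it IS `LatticeFieldCalculus.curl 1` of the bond field (`LatticeFieldCalculus.curl_eq_pdiff`). [cite: Balaban1985BackgroundPropagators, (3.4) p.391; Balaban1984PropagatorsI, (1.2) p.18] -/
theorem curl_torusT_one_eq_curl_one (A : VecField P j (Matrix (Fin N) (Fin N) ℂ)) {μ ν : Fin P.d} (h : μ < ν) (x : Site P j) :
    B9Eq39Adjoint.curl (torusT P j) (fun _ _ => (1 : (Matrix (Fin N) (Fin N) ℂ)ˣ)) (fun κ y => A ⟨y, κ⟩) μ ν x = curl 1 A ⟨x, μ, ν, h⟩ := by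
  rw [curl_torusT_one_eq_pdiff, LatticeFieldCalculus.curl_eq_pdiff]

variable [NeZero N]

/-- ★ **THE FLAT HESSIAN OPERATOR OF RECORD AS AN ENTRYWISE SUM OF SQUARES OVER `Plaq`**: `⟪X, Δ_1 X⟫ = N⁻¹ · Σ_{p : Plaq} Σ_{i,i′} |(curl 1 X)(p)_{ii′}|²` — «the operator
`∂*∂` in the Abelian case» ([5] p. 392) with `∂ = LatticeFieldCalculus.curl 1` (S1 `hessFormAt_one_self` ∕ dag-n07-w1's `pdiff` form; `posPlaq` ↔ `Plaq` by
`sum_plaq_eq_sum_site`; `Re tr(M*M) = Σ|M_{ii′}|²`). [cite: Balaban1985BackgroundPropagators, (3.10) p.392, (3.4) p.391; Balaban1984PropagatorsI, (1.2) p.18] -/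
theorem inner_hessOpAt_one_self_eq_sum_curl_normSq {η : ℝ} (hη : η ≠ 0) (X : TangentBondSU P j N) :
    ⟪X, hessOpAt η (1 : GaugeField P j (SU N)) X⟫_ℝ =
      (N : ℝ)⁻¹ * ∑ p : Plaq P j, ∑ i, ∑ i',
        ‖curl 1 (fun b => ((X b : lieSU (Fin N)) : Matrix (Fin N) (Fin N) ℂ)) p i i'‖ ^ 2 := by
  rw [inner_hessOpAt, hessFormAt_one_self hη]
  congr 1
  rw [sum_plaq_eq_sum_site,
    B9Eq39Adjoint.sum_posPlaq (fun x μ ν =>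
      (Matrix.conjTranspose
          (B9Eq39Adjoint.curl (torusT P j) (fun _ _ => (1 : (Matrix (Fin N) (Fin N) ℂ)ˣ))
            (fun κ y => ((X ⟨y, κ⟩ : lieSU (Fin N)) : Matrix (Fin N) (Fin N) ℂ)) μ ν x) *
        B9Eq39Adjoint.curl (torusT P j) (fun _ _ => (1 : (Matrix (Fin N) (Fin N) ℂ)ˣ))
          (fun κ y => ((X ⟨y, κ⟩ : lieSU (Fin N)) : Matrix (Fin N) (Fin N) ℂ)) μ ν x).trace.re)]
  refine Finset.sum_congr rfl fun x _ => Finset.sum_congr rfl fun μ _ => Finset.sum_congr rfl fun ν _ => ?_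
  by_cases h : μ < ν
  · rw [if_pos h, dif_pos h, MatrixNorms.sum_norm_sq_eq_re_trace,
      curl_torusT_one_eq_curl_one (fun b => ((X b : lieSU (Fin N)) : Matrix (Fin N) (Fin N) ℂ)) h x]
  · rw [if_neg h, dif_neg h]

/-- The same split into the `2N²` REAL components: `⟪X, Δ_1 X⟫ = N⁻¹ · Σ_{i,i′} (Σ_p (curl 1 (Re X_{ii′}))(p)² + Σ_p (curl 1 (Im X_{ii′}))(p)²)`.
[cite: Balaban1985BackgroundPropagators, (3.10) p.392; Balaban1985Variational, p.288 («suppressed matrix indices»)] -/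
theorem inner_hessOpAt_one_self_eq_sum_curl_re_im {η : ℝ} (hη : η ≠ 0) (X : TangentBondSU P j N) :
    ⟪X, hessOpAt η (1 : GaugeField P j (SU N)) X⟫_ℝ =
      (N : ℝ)⁻¹ * ∑ i, ∑ i',
        (∑ p : Plaq P j, curl 1 (fun b => (((X b : lieSU (Fin N)) : Matrix (Fin N) (Fin N) ℂ) i i').re) p ^ 2 +
          ∑ p : Plaq P j, curl 1 (fun b => (((X b : lieSU (Fin N)) : Matrix (Fin N) (Fin N) ℂ) i i').im) p ^ 2) := by
  rw [inner_hessOpAt_one_self_eq_sum_curl_normSq hη]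
  congr 1
  rw [Finset.sum_comm]
  refine Finset.sum_congr rfl fun i _ => ?_
  rw [Finset.sum_comm]
  refine Finset.sum_congr rfl fun i' _ => ?_
  rw [← Finset.sum_add_distrib]
  refine Finset.sum_congr rfl fun p _ => ?_
  rw [Complex.sq_norm, Complex.normSq_apply, curl_entry_re, curl_entry_im]; ring

omit [NeZero N] in
/-- Bookkeeping: a sum of squared entry moduli of a family of matrices, split into the `2N²` real components and re-indexed by the entry.
[folklore] -/
theorem sum_entries_re_im {ι : Type*} [Fintype ι] (G : ι → Matrix (Fin N) (Fin N) ℂ) :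
    ∑ t, ∑ i, ∑ i', ‖G t i i'‖ ^ 2 = ∑ i, ∑ i', (∑ t, (G t i i').re ^ 2 + ∑ t, (G t i i').im ^ 2) := by
  rw [Finset.sum_comm]
  refine Finset.sum_congr rfl fun i _ => ?_
  rw [Finset.sum_comm]
  refine Finset.sum_congr rfl fun i' _ => ?_
  rw [← Finset.sum_add_distrib]
  exact Finset.sum_congr rfl fun t _ => by rw [Complex.sq_norm, Complex.normSq_apply]; ring

/-! ## §2  ★★ [B5] Prop. 1.1 (1.90) for 𝔰𝔲(N)-valued bond fields at the record's fine torus: `Δ_1` of record is coercive on Landau ∩ `ker Q_k` -/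

section Record

variable (F : T4Family) (K k : ℕ)

/-- ★★ **[B5] PROP. 1.1 (1.90), HODGE FORM, FOR 𝔰𝔲(N)-VALUED BOND FIELDS AT THE RECORD, WITH S1's HESSIAN OPERATOR** (fine torus `Site (F.P K) 0`, `k ≤ m + K`
averaging levels, every `N ≥ 1`, every `η ≠ 0`): for every `X : TangentBondSU (F.P K) 0 N`,
`‖X‖² ≤ 2L^{4k}·Σ_c Σ_{ii′} |(Q_kX)(c)_{ii′}|² + (17∕8)·L^{2k}·(N·⟪X, Δ_1X⟫ + Σ_x Σ_{ii′} |(∂*X)(x)_{ii′}|²)` — `Q_k = bondAvgIter k`, `∂* = diverg 1`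
ENTRYWISE on the matrix field `b ↦ X_b ∈ 𝔰𝔲(N) ⊂ M_N(ℂ)`, `Δ_1 = Node00.hessOpAt η 1` (its form is `N⁻¹·Σ_p Σ_{ii′}|(∂X)(p)_{ii′}|²`, §1); constants independent of
`m`, `K`, `k`, `N`.  File 3's `sum_sq_le_bondAvgIter_add_curl_add_diverg_T4` (UST `Prop7FlatCoercivity`) on each of the `2N²` real components, summed.
[cite: Balaban1984PropagatorsI, Prop. 1.1 (1.90) p.33; Balaban1985BackgroundPropagators, (3.10) p.392; Balaban1985Variational, p.288] -/
theorem normSq_le_bondAvgIter_add_hessOpAt_add_diverg_T4 (hk : k ≤ F.m + K) {η : ℝ} (hη : η ≠ 0) (X : TangentBondSU (F.P K) 0 N) :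
    ‖X‖ ^ 2 ≤
      2 * ((F.L : ℝ) ^ k) ^ 4 * ∑ c : PBond (F.P K) k, ∑ i, ∑ i',
          ‖bondAvgIter k (fun b => ((X b : lieSU (Fin N)) : Matrix (Fin N) (Fin N) ℂ)) c i i'‖ ^ 2
        + (17 / 8) * ((F.L : ℝ) ^ k) ^ 2 *
          ((N : ℝ) * ⟪X, hessOpAt η (1 : GaugeField (F.P K) 0 (SU N)) X⟫_ℝ
            + ∑ x : Site (F.P K) 0, ∑ i, ∑ i', ‖diverg 1 (fun b => ((X b : lieSU (Fin N)) : Matrix (Fin N) (Fin N) ℂ)) x i i'‖ ^ 2) := by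
  set A : VecField (F.P K) 0 (Matrix (Fin N) (Fin N) ℂ) := fun b => ((X b : lieSU (Fin N)) : Matrix (Fin N) (Fin N) ℂ)
  have hN : (N : ℝ) ≠ 0 := Nat.cast_ne_zero.mpr (NeZero.ne N)
  -- the four matrix-side quantities in the `2N²` real components
  have hX : ‖X‖ ^ 2 = ∑ i, ∑ i', (∑ b, (A b i i').re ^ 2 + ∑ b, (A b i i').im ^ 2) := by
    rw [normSq_tangentBondSU_eq_sum_entries, sum_entries_re_im]
  have hH : (N : ℝ) * ⟪X, hessOpAt η (1 : GaugeField (F.P K) 0 (SU N)) X⟫_ℝ =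
      ∑ i, ∑ i', (∑ p, curl 1 (fun b => (A b i i').re) p ^ 2 + ∑ p, curl 1 (fun b => (A b i i').im) p ^ 2) := by
    rw [inner_hessOpAt_one_self_eq_sum_curl_re_im hη, ← mul_assoc, mul_inv_cancel₀ hN, one_mul]
  have hQ : ∑ c : PBond (F.P K) k, ∑ i, ∑ i', ‖bondAvgIter k A c i i'‖ ^ 2 =
      ∑ i, ∑ i', (∑ c, bondAvgIter k (fun b => (A b i i').re) c ^ 2 + ∑ c, bondAvgIter k (fun b => (A b i i').im) c ^ 2) := by
    rw [sum_entries_re_im]; simp only [bondAvgIter_entry_re, bondAvgIter_entry_im]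
  have hD : ∑ x : Site (F.P K) 0, ∑ i, ∑ i', ‖diverg 1 A x i i'‖ ^ 2 =
      ∑ i, ∑ i', (∑ x, diverg 1 (fun b => (A b i i').re) x ^ 2 + ∑ x, diverg 1 (fun b => (A b i i').im) x ^ 2) := by
    rw [sum_entries_re_im]; simp only [diverg_entry_re, diverg_entry_im]
  rw [hX, hQ, hD, hH]
  -- file 3's (1.90) on each of the `2N²` real components (`(F.P K).L = F.L`, `(F.P K).d = 4` by `rfl`), summed
  have hcomp : ∀ Y : VecField (F.P K) 0 ℝ, ∑ b, Y b ^ 2 ≤ 2 * ((F.L : ℝ) ^ k) ^ 4 * ∑ c, bondAvgIter k Y c ^ 2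
      + (17 / 8) * ((F.L : ℝ) ^ k) ^ 2 * (∑ p, curl 1 Y p ^ 2 + ∑ x, diverg 1 Y x ^ 2) := fun Y => by
    simpa only [T4Family.P_L, T4Family.P_d] using sum_sq_le_bondAvgIter_add_curl_add_diverg_T4 F K k hk Y
  calc ∑ i, ∑ i', (∑ b, (A b i i').re ^ 2 + ∑ b, (A b i i').im ^ 2)
      ≤ _ := Finset.sum_le_sum fun i _ => Finset.sum_le_sum fun i' _ =>
          add_le_add (hcomp fun b => (A b i i').re) (hcomp fun b => (A b i i').im)
    _ = _ := by simp only [Finset.sum_add_distrib, ← Finset.mul_sum]; ring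

/-- ★★ **`Δ_1` OF RECORD IS COERCIVE ON THE LANDAU ∩ `ker Q_k` TANGENT SPACE, `k`- AND VOLUME-UNIFORMLY** ([B5] (1.89)–(1.90) = the flat case of [5] Thm 3.11, `L²` form):
for an 𝔰𝔲(N)-valued `X` on `Site (F.P K) 0` with `∂*X = 0` (entrywise Landau) and `Q_kX = 0` (`k ≤ m + K`),
`(8∕17)·L^{−2k}·‖X‖² ≤ N·⟪X, Δ_1 X⟫` — the positivity of the flat linearised Wilson Hessian of S1 on the one-level flat tangent space, the `hpos` input of file 2's
(127) ⟹ (143) ⟹ (158). [cite: Balaban1984PropagatorsI, Prop. 1.1 (1.89)–(1.90) p.33; Balaban1985BackgroundPropagators, Thm 3.11 p.416; Balaban1985Variational, (128)–(131) p.298] -/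
theorem hessOpAt_one_coercive_of_landau_of_bondAvgIter_eq_zero_T4 (hk : k ≤ F.m + K) {η : ℝ} (hη : η ≠ 0) (X : TangentBondSU (F.P K) 0 N)
    (hdiv : ∀ x : Site (F.P K) 0, diverg 1 (fun b => ((X b : lieSU (Fin N)) : Matrix (Fin N) (Fin N) ℂ)) x = 0)
    (havg : ∀ c : PBond (F.P K) k, bondAvgIter k (fun b => ((X b : lieSU (Fin N)) : Matrix (Fin N) (Fin N) ℂ)) c = 0) :
    (8 / 17) * (((F.L : ℝ) ^ k) ^ 2)⁻¹ * ‖X‖ ^ 2 ≤ (N : ℝ) * ⟪X, hessOpAt η (1 : GaugeField (F.P K) 0 (SU N)) X⟫_ℝ := by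
  set A : VecField (F.P K) 0 (Matrix (Fin N) (Fin N) ℂ) := fun b => ((X b : lieSU (Fin N)) : Matrix (Fin N) (Fin N) ℂ)
  have hN : (N : ℝ) ≠ 0 := Nat.cast_ne_zero.mpr (NeZero.ne N)
  have hX : ‖X‖ ^ 2 = ∑ i, ∑ i', (∑ b, (A b i i').re ^ 2 + ∑ b, (A b i i').im ^ 2) := by
    rw [normSq_tangentBondSU_eq_sum_entries, sum_entries_re_im]
  have hH : (N : ℝ) * ⟪X, hessOpAt η (1 : GaugeField (F.P K) 0 (SU N)) X⟫_ℝ =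
      ∑ i, ∑ i', (∑ p, curl 1 (fun b => (A b i i').re) p ^ 2 + ∑ p, curl 1 (fun b => (A b i i').im) p ^ 2) := by
    rw [inner_hessOpAt_one_self_eq_sum_curl_re_im hη, ← mul_assoc, mul_inv_cancel₀ hN, one_mul]
  -- the Landau and kernel hypotheses entrywise
  have hdiv_re : ∀ (i i' : Fin N) (x : Site (F.P K) 0), diverg 1 (fun b => (A b i i').re) x = 0 := fun i i' x => by
    rw [← diverg_entry_re, hdiv x, Matrix.zero_apply, Complex.zero_re]
  have hdiv_im : ∀ (i i' : Fin N) (x : Site (F.P K) 0), diverg 1 (fun b => (A b i i').im) x = 0 := fun i i' x => by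
    rw [← diverg_entry_im, hdiv x, Matrix.zero_apply, Complex.zero_im]
  have havg_re : ∀ (i i' : Fin N) (c : PBond (F.P K) k), bondAvgIter k (fun b => (A b i i').re) c = 0 := fun i i' c => by
    rw [← bondAvgIter_entry_re, havg c, Matrix.zero_apply, Complex.zero_re]
  have havg_im : ∀ (i i' : Fin N) (c : PBond (F.P K) k), bondAvgIter k (fun b => (A b i i').im) c = 0 := fun i i' c => by
    rw [← bondAvgIter_entry_im, havg c, Matrix.zero_apply, Complex.zero_im]
  -- file 3's kernel form of (1.90) on each real component, summed
  have hcomp : ∀ i i' : Fin N,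
      (8 / 17) * (((F.L : ℝ) ^ k) ^ 2)⁻¹ * (∑ b, (A b i i').re ^ 2 + ∑ b, (A b i i').im ^ 2) ≤
        ∑ p, curl 1 (fun b => (A b i i').re) p ^ 2 + ∑ p, curl 1 (fun b => (A b i i').im) p ^ 2 := by
    intro i i'
    rw [mul_add]
    exact add_le_add (curl_sq_ge_of_landau_of_bondAvgIter_eq_zero_T4 F K k hk (fun b => (A b i i').re) (hdiv_re i i') (havg_re i i'))
      (curl_sq_ge_of_landau_of_bondAvgIter_eq_zero_T4 F K k hk (fun b => (A b i i').im) (hdiv_im i i') (havg_im i i'))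
  rw [hX, hH, Finset.mul_sum]
  refine Finset.sum_le_sum fun i _ => ?_
  rw [Finset.mul_sum]
  exact Finset.sum_le_sum fun i' _ => hcomp i i'

end Record

/-! ## §3  ★ The same in PRINT's pairing (3.11) at `η = η_k`: «`Δ(1) ≥ γ₀` on the Landau tangent space», `γ₀ = 8∕17` -/

section PrintPairing

open scoped Matrix.Norms.L2Operator
open B9Eq39Adjoint (bondPair hessPair)
open B12Eq18Current (dirForm)

variable (F : T4Family) (K k : ℕ)

omit [NeZero N] in
/-- The record's scale at `k` levels above the fine torus: `η_k = (F.P K).eta k = L^{−k} > 0`. [cite: Balaban1987RG1, (0.1) p.251 (bookkeeping)] -/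
theorem eta_T4_eq : (F.P K).eta k = (((F.L : ℝ) ^ k))⁻¹ ∧ 0 < (F.P K).eta k := by
  have hL : (0 : ℝ) < F.L := Nat.cast_pos.mpr (lt_trans Nat.zero_lt_one F.hL.2)
  have h : (F.P K).eta k = (((F.L : ℝ) ^ k))⁻¹ := by rw [Params.eta, T4Family.P_L, inv_pow]
  exact ⟨h, h ▸ by positivity⟩

/-- ★ **[B5] (1.89)–(1.90) IN PRINT's OWN PAIRING (3.11) AT THE RECORD, FLAT, ON THE LANDAU ∩ `ker Q_k` TANGENT SPACE**: at `η = η_k = L^{−k}` (the fine torus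
`Site (F.P K) 0` read as the `η`-lattice with unit lattice `T^{(k)}`), for every 𝔰𝔲(N)-valued `X` with `∂*X = 0` and `Q_kX = 0` (`k ≤ m + K`),
`(8∕17)·Re⟨A_X, A_X⟩ ≤ Re⟨A_X, Δ^{η_k}(1) A_X⟩` — print's hermitian letter `A_X = (iη)⁻¹X` (S1 `hermLetter`), pv27's pairing `bondPair` (3.11) and quadratic form
`hessPair` (3.10) at the trivial datum; i.e. «`Δ(1) ≥ γ₀·I`» on that space with `γ₀ = 8∕17`, independent of `k`, `m`, `K`, `N` (S1's dictionary
`re_bondPair_hermLetter`: `Re⟨A_X, A_Y⟩ = (η²∕N)·⟪X, Y⟫`, and `inner_hessOpAt_self`). [cite: Balaban1984PropagatorsI, Prop. 1.1 (1.89)–(1.90) p.33; Balaban1985BackgroundPropagators, (3.10)–(3.11) p.392, Thm 3.11 p.416] -/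
theorem re_bondPair_le_re_hessPair_of_landau_T4 (hk : k ≤ F.m + K) (X : TangentBondSU (F.P K) 0 N)
    (hdiv : ∀ x : Site (F.P K) 0, diverg 1 (fun b => ((X b : lieSU (Fin N)) : Matrix (Fin N) (Fin N) ℂ)) x = 0)
    (havg : ∀ c : PBond (F.P K) k, bondAvgIter k (fun b => ((X b : lieSU (Fin N)) : Matrix (Fin N) (Fin N) ℂ)) c = 0) :
    (8 / 17) * (bondPair ((F.P K).eta k) 4 ((N : ℂ)⁻¹ • Matrix.traceLinearMap (Fin N) ℂ ℂ)
        (hermLetter ((F.P K).eta k) (1 : GaugeField (F.P K) 0 (SU N)) X)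
        (hermLetter ((F.P K).eta k) (1 : GaugeField (F.P K) 0 (SU N)) X)).re
      ≤ (hessPair (torusT (F.P K) 0) (dirForm (cfgGL N (1 : GaugeField (F.P K) 0 (SU N)))) ((F.P K).eta k) 4
          ((N : ℂ)⁻¹ • Matrix.traceLinearMap (Fin N) ℂ ℂ) (hermLetter ((F.P K).eta k) (1 : GaugeField (F.P K) 0 (SU N)) X)).re := by
  have hη : (F.P K).eta k ≠ 0 := (eta_T4_eq F K k).2.ne'
  have hN : (N : ℝ) ≠ 0 := Nat.cast_ne_zero.mpr (NeZero.ne N)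
  have hNpos : (0 : ℝ) < N := Nat.cast_pos.mpr (Nat.pos_of_ne_zero (NeZero.ne N))
  have h := hessOpAt_one_coercive_of_landau_of_bondAvgIter_eq_zero_T4 F K k hk hη X hdiv havg
  have hη2 : ((F.P K).eta k) ^ 2 = (((F.L : ℝ) ^ k) ^ 2)⁻¹ := by rw [(eta_T4_eq F K k).1, inv_pow]
  rw [re_bondPair_hermLetter hη, ← inner_hessOpAt_self, real_inner_self_eq_norm_sq, hη2]
  calc (8 / 17) * ((((F.L : ℝ) ^ k) ^ 2)⁻¹ / N * ‖X‖ ^ 2)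
      = (N : ℝ)⁻¹ * ((8 / 17) * (((F.L : ℝ) ^ k) ^ 2)⁻¹ * ‖X‖ ^ 2) := by ring
    _ ≤ (N : ℝ)⁻¹ * ((N : ℝ) * ⟪X, hessOpAt ((F.P K).eta k) (1 : GaugeField (F.P K) 0 (SU N)) X⟫_ℝ) :=
        mul_le_mul_of_nonneg_left h (inv_nonneg.mpr hNpos.le)
    _ = ⟪X, hessOpAt ((F.P K).eta k) (1 : GaugeField (F.P K) 0 (SU N)) X⟫_ℝ := by
        rw [← mul_assoc, inv_mul_cancel₀ hN, one_mul]

end PrintPairing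

/-! ## §4  ★ Consequences on S1's carrier: file 2's `hpos` discharged; print's `G̃` of (143)∕(158) exists; (127) ⟹ (158) at the flat background -/

section Consequences

variable (F : T4Family) (K k : ℕ)

/-- ★ **FILE 2's `hpos` ON S1's CARRIER, DISCHARGED AT THE FLAT BACKGROUND**: for every tangent subspace `T` of 𝔰𝔲(N)-valued bond fields of the record's fine torus
contained in the Landau ∩ `ker Q_k` fields (`k ≤ m + K`), `Δ_1 = hessOpAt η 1` is POSITIVE on `T`: `z ∈ T`, `z ≠ 0 ⇒ 0 < ⟪z, Δ_1 z⟫` — print's «`Δ_a` … is positive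
definite» ((128)–(129)) on the flat one-level tangent space, where the `DRD*` and `aQ*Q` terms vanish. [cite: Balaban1985Variational, (128)–(131) p.298; Balaban1984PropagatorsI, Prop. 1.1 (1.90) p.33] -/
theorem hessOpAt_one_pos_of_le_landau_ker_T4 (hk : k ≤ F.m + K) {η : ℝ} (hη : η ≠ 0) (T : Submodule ℝ (TangentBondSU (F.P K) 0 N))
    (hT : ∀ X ∈ T, (∀ x : Site (F.P K) 0, diverg 1 (fun b => ((X b : lieSU (Fin N)) : Matrix (Fin N) (Fin N) ℂ)) x = 0) ∧
      ∀ c : PBond (F.P K) k, bondAvgIter k (fun b => ((X b : lieSU (Fin N)) : Matrix (Fin N) (Fin N) ℂ)) c = 0) :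
    ∀ z ∈ T, z ≠ 0 → 0 < ⟪z, hessOpAt η (1 : GaugeField (F.P K) 0 (SU N)) z⟫_ℝ := by
  intro z hz hz0
  have h := hessOpAt_one_coercive_of_landau_of_bondAvgIter_eq_zero_T4 F K k hk hη z (hT z hz).1 (hT z hz).2
  have hNpos : (0 : ℝ) < N := Nat.cast_pos.mpr (Nat.pos_of_ne_zero (NeZero.ne N))
  have hL : (0 : ℝ) < F.L := Nat.cast_pos.mpr (lt_trans Nat.zero_lt_one F.hL.2)
  have hzn : 0 < ‖z‖ := norm_pos_iff.mpr hz0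
  have hlhs : 0 < (8 / 17) * (((F.L : ℝ) ^ k) ^ 2)⁻¹ * ‖z‖ ^ 2 := by positivity
  exact (mul_pos_iff_of_pos_left hNpos).mp (lt_of_lt_of_le hlhs h)

/-- The `L²` letter of a restricted solution of `Δ_1` on such a `T`: if `z ∈ T` has `⟪δ, Δ_1 z⟫ = ⟪δ, v⟫` for all `δ ∈ T`, then `‖z‖ ≤ (17∕8)·N·L^{2k}·‖v‖`
(take `δ = z`: `(8∕17)L^{−2k}‖z‖² ≤ N⟪z, Δ_1z⟫ = N⟪z, v⟩ ≤ N‖z‖‖v‖`). [cite: Balaban1984PropagatorsI, Prop. 1.1 (1.90) p.33; Balaban1985Variational, (46) p.285, (131) p.298] -/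
theorem norm_restricted_solution_hessOpAt_le_T4 (hk : k ≤ F.m + K) {η : ℝ} (hη : η ≠ 0) (T : Submodule ℝ (TangentBondSU (F.P K) 0 N))
    (hT : ∀ X ∈ T, (∀ x : Site (F.P K) 0, diverg 1 (fun b => ((X b : lieSU (Fin N)) : Matrix (Fin N) (Fin N) ℂ)) x = 0) ∧
      ∀ c : PBond (F.P K) k, bondAvgIter k (fun b => ((X b : lieSU (Fin N)) : Matrix (Fin N) (Fin N) ℂ)) c = 0)
    {z v : TangentBondSU (F.P K) 0 N} (hz : z ∈ T)
    (hsol : ∀ δ ∈ T, ⟪δ, hessOpAt η (1 : GaugeField (F.P K) 0 (SU N)) z⟫_ℝ = ⟪δ, v⟫_ℝ) :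
    ‖z‖ ≤ (17 / 8) * N * ((F.L : ℝ) ^ k) ^ 2 * ‖v‖ := by
  have h := hessOpAt_one_coercive_of_landau_of_bondAvgIter_eq_zero_T4 F K k hk hη z (hT z hz).1 (hT z hz).2
  rw [hsol z hz] at h
  have hNpos : (0 : ℝ) < N := Nat.cast_pos.mpr (Nat.pos_of_ne_zero (NeZero.ne N))
  have hL : (0 : ℝ) < F.L := Nat.cast_pos.mpr (lt_trans Nat.zero_lt_one F.hL.2)
  have hc : (0 : ℝ) < ((F.L : ℝ) ^ k) ^ 2 := by positivity
  have hcs : ⟪z, v⟫_ℝ ≤ ‖z‖ * ‖v‖ := real_inner_le_norm _ _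
  by_cases hz0 : ‖z‖ = 0
  · rw [hz0]; positivity
  · have hzpos : 0 < ‖z‖ := lt_of_le_of_ne (norm_nonneg _) (Ne.symm hz0)
    have h1 : (8 / 17) * (((F.L : ℝ) ^ k) ^ 2)⁻¹ * ‖z‖ ^ 2 ≤ (N : ℝ) * (‖z‖ * ‖v‖) :=
      h.trans (mul_le_mul_of_nonneg_left hcs hNpos.le)
    have h2 : ‖z‖ ^ 2 ≤ (17 / 8) * N * ((F.L : ℝ) ^ k) ^ 2 * (‖z‖ * ‖v‖) := by
      have h3 := mul_le_mul_of_nonneg_left h1 (show (0 : ℝ) ≤ (17 / 8) * ((F.L : ℝ) ^ k) ^ 2 by positivity)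
      have hcc : (17 / 8) * ((F.L : ℝ) ^ k) ^ 2 * ((8 / 17) * (((F.L : ℝ) ^ k) ^ 2)⁻¹ * ‖z‖ ^ 2) = ‖z‖ ^ 2 := by
        field_simp
      rw [hcc] at h3
      calc ‖z‖ ^ 2 ≤ (17 / 8) * ((F.L : ℝ) ^ k) ^ 2 * ((N : ℝ) * (‖z‖ * ‖v‖)) := h3
        _ = (17 / 8) * N * ((F.L : ℝ) ^ k) ^ 2 * (‖z‖ * ‖v‖) := by ring
    nlinarith [h2, hzpos, norm_nonneg v]

/-- ★ **PRINT's `G̃` ((131) «`P₀ = I − GQ*(QGQ*)⁻¹Q`», (143) «`GP₀* = G̃`») EXISTS ON S1's CARRIER AT THE FLAT BACKGROUND, WITH A `k`-UNIFORM `L²` LETTER**: for every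
tangent subspace `T ⊆` Landau ∩ `ker Q_k` of `TangentBondSU (F.P K) 0 N` (`k ≤ m + K`) there is an ℝ-linear `G̃` with values in `T`, `⟪δ, Δ_1(G̃w)⟫ = ⟪δ, w⟫` on `T`
(the restricted solution operator of file 2 for `Δ := Δ_1`), UNIQUE, and `‖G̃w‖ ≤ (17∕8)·N·L^{2k}·‖w‖`. [cite: Balaban1985Variational, (131) p.298, (143) p.300, (158) p.302; Balaban1984PropagatorsI, Prop. 1.1 (1.90) p.33] -/
theorem exists_flatGt_hessOpAt_T4 (hk : k ≤ F.m + K) {η : ℝ} (hη : η ≠ 0) (T : Submodule ℝ (TangentBondSU (F.P K) 0 N))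
    (hT : ∀ X ∈ T, (∀ x : Site (F.P K) 0, diverg 1 (fun b => ((X b : lieSU (Fin N)) : Matrix (Fin N) (Fin N) ℂ)) x = 0) ∧
      ∀ c : PBond (F.P K) k, bondAvgIter k (fun b => ((X b : lieSU (Fin N)) : Matrix (Fin N) (Fin N) ℂ)) c = 0) :
    ∃ G : TangentBondSU (F.P K) 0 N →ₗ[ℝ] TangentBondSU (F.P K) 0 N,
      (∀ w, G w ∈ T ∧ ∀ δ ∈ T, ⟪δ, hessOpAt η (1 : GaugeField (F.P K) 0 (SU N)) (G w)⟫_ℝ = ⟪δ, w⟫_ℝ) ∧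
      (∀ w z : TangentBondSU (F.P K) 0 N, z ∈ T →
        (∀ δ ∈ T, ⟪δ, hessOpAt η (1 : GaugeField (F.P K) 0 (SU N)) z⟫_ℝ = ⟪δ, w⟫_ℝ) → z = G w) ∧
      ∀ w, ‖G w‖ ≤ (17 / 8) * N * ((F.L : ℝ) ^ k) ^ 2 * ‖w‖ := by
  obtain ⟨G, hG, huniq⟩ := exists_restrictedSolutionOp T (hessOpAt η (1 : GaugeField (F.P K) 0 (SU N)))
    (hessOpAt_one_pos_of_le_landau_ker_T4 F K k hk hη T hT)
  exact ⟨G, hG, huniq, fun w => norm_restricted_solution_hessOpAt_le_T4 F K k hk hη T hT (hG w).1 (hG w).2⟩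

/-- ★ **[15] (127) ⟹ (158) ON S1's CARRIER AT THE FLAT BACKGROUND, `hpos` DISCHARGED**: for every ℝ-linear constraint map `Qc` on `TangentBondSU (F.P K) 0 N` whose kernel
(the tangent space `{QδA′ = 0}` of (127)∕(131)) lies inside the Landau ∩ `ker Q_k` fields (e.g. `Qc = (Q_k, ∂*)` jointly; `k ≤ m + K`), and every right inverse `H` of `Qc`
whose range is `Δ_1`-orthogonal to `ker Qc` (print's `H₀` (129) ∕ Sect. F's `H` (157)), there is an ℝ-linear `G̃` (values in `ker Qc`, `⟪δ, Δ_1(G̃v)⟫ = ⟪δ, v⟫` on `ker Qc`)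
such that for EVERY map `W` (print: `(δ∕δA′)V`) and every `A′` critical in the sense (128) — `⟪δ, Δ_1A′ + W(A′)⟫ = 0` for all `δ ∈ ker Qc` — the tangent component
`A₁ := A′ − H(QcA′)` solves *«A₁ + G̃((δ∕δA′)V)(A₁ + HB) = 0. (158)»*, `B := QcA′`.  File 2's `exists_Gt_eq158_of_critical128` with `Δ_a := Δ_1` and `hpos` from §4.
[cite: Balaban1985Variational, (127)–(133) pp.297–298, (143) p.300, (158) p.302] -/
theorem exists_Gt_eq158_hessOpAt_T4 (hk : k ≤ F.m + K) {η : ℝ} (hη : η ≠ 0) {Fc : Type*} [AddCommGroup Fc] [Module ℝ Fc]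
    (Qc : TangentBondSU (F.P K) 0 N →ₗ[ℝ] Fc)
    (hQc : ∀ X ∈ LinearMap.ker Qc, (∀ x : Site (F.P K) 0, diverg 1 (fun b => ((X b : lieSU (Fin N)) : Matrix (Fin N) (Fin N) ℂ)) x = 0) ∧
      ∀ c : PBond (F.P K) k, bondAvgIter k (fun b => ((X b : lieSU (Fin N)) : Matrix (Fin N) (Fin N) ℂ)) c = 0)
    (H : Fc →ₗ[ℝ] TangentBondSU (F.P K) 0 N) (hQH : ∀ B, Qc (H B) = B)
    (hHorth : ∀ δ ∈ LinearMap.ker Qc, ∀ B, ⟪δ, hessOpAt η (1 : GaugeField (F.P K) 0 (SU N)) (H B)⟫_ℝ = 0) :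
    ∃ G : TangentBondSU (F.P K) 0 N →ₗ[ℝ] TangentBondSU (F.P K) 0 N,
      (∀ v, G v ∈ LinearMap.ker Qc ∧ ∀ δ ∈ LinearMap.ker Qc, ⟪δ, hessOpAt η (1 : GaugeField (F.P K) 0 (SU N)) (G v)⟫_ℝ = ⟪δ, v⟫_ℝ) ∧
      ∀ (W : TangentBondSU (F.P K) 0 N → TangentBondSU (F.P K) 0 N) (A' : TangentBondSU (F.P K) 0 N),
        (∀ δ ∈ LinearMap.ker Qc, ⟪δ, hessOpAt η (1 : GaugeField (F.P K) 0 (SU N)) A' + W A'⟫_ℝ = 0) →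
        (A' - H (Qc A')) + G (W ((A' - H (Qc A')) + H (Qc A'))) = 0 :=
  exists_Gt_eq158_of_critical128 (hessOpAt η (1 : GaugeField (F.P K) 0 (SU N))) Qc
    (hessOpAt_one_pos_of_le_landau_ker_T4 F K k hk hη (LinearMap.ker Qc) hQc) H hQH hHorth

end Consequences

end Summit.QuantumFields.YangMills.Theorems.K0Stub1FlatHessianLandauCoercivity

end
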